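import Summits.HubbardSuperconductivity.HubbardSuperconductivity.Theorems.AnisotropyChordInsertionEntropySheetCanonical

/-!
# Route `AnisotropyChord` / H0 rotor rung: the canonical Jastrow–sheet chain — per-volume hypotheses discharged
# (`1 ≤ N ≤ |Λ| − 1` suffices) and independence of the diagonal value `c`
# (port of theory seat `hubbard-h0-rotor-theory-1`, Sketch9 Parts K–L, memo ROTOR-THEORY-9 §135(j), tree currency)

* `jastrowSectorWeight_pos_of_le` (`N ≤ |V| ⇒ Z_N > 0`) and `pairMass_jastrowSectorAmp_pos` (every ordered pair
  `x ≠ y` admits a template in sector `N` when `1 ≤ N ≤ |V| − 1`), for ANY kernel `w`;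
* ★′ `condensateDensity_sheetSector_ge_of_entropyBoundC'` / `…_of_defectC'`: the condensate floor of
  `…InsertionEntropySheetCanonical` with the two per-volume hypotheses replaced by `1 ≤ N_L ≤ L² − 1`;
* **c-independence (PROVED):** shifting the diagonal of the pair kernel by `c` multiplies the Jastrow amplitude by
  `e^{−cN(σ)/4}` (`jastrowAmp_sheet_diag`), so the normalised canonical state does not depend on `c` at all
  (`jastrowSectorAmp_sheet_indep`); hence neither do R8ᶜ/R8aᶜ/R8bᶜ (`…C_indep`).  WLOG `c = 0`.
-/

set_option linter.dupNamespace false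

noncomputable section

open Finset
open Literature.Probability.LatticeModels

namespace Summit.HubbardSuperconductivity.HubbardSuperconductivity.Theorems.AnisotropyChord.InsertionEntropy

section SheetSector

variable {V : Type} [Fintype V] [DecidableEq V]

/-- A sector `N ≤ |V|` is non-empty: `Z_N > 0`. [folklore] -/
theorem jastrowSectorWeight_pos_of_le (w : V → V → ℝ) (N : ℕ) (hN : N ≤ Fintype.card V) :
    0 < jastrowSectorWeight w N :=
  jastrowSectorWeight_pos w N (exists_particleCount_eq N hN)

/-- Every ordered pair `x ≠ y` admits a template in sector `N` when `1 ≤ N ≤ |V| − 1`: the pair mass `a_{xy}` of the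
canonical Jastrow state is positive. (theory seat Sketch9 Part K `pairMass_sectorAmp_pos`) [folklore] -/
theorem pairMass_jastrowSectorAmp_pos (w : V → V → ℝ) (N : ℕ) (hN1 : 1 ≤ N) (hN2 : N + 1 ≤ Fintype.card V)
    (x y : V) (hxy : x ≠ y) : 0 < pairMass (jastrowSectorAmp w N) x y := by
  classical
  have hZ : 0 < jastrowSectorWeight w N := jastrowSectorWeight_pos_of_le w N (by omega)
  have hcard : N - 1 ≤ (((Finset.univ : Finset V).erase x).erase y).card := by
    rw [Finset.card_erase_of_mem (Finset.mem_erase.mpr ⟨fun h => hxy h.symm, Finset.mem_univ y⟩),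
      Finset.card_erase_of_mem (Finset.mem_univ x), Finset.card_univ]
    omega
  obtain ⟨t, hts, ht⟩ := Finset.exists_subset_card_eq hcard
  have hxt : x ∉ t := fun h => by
    have := hts h
    simp at this
  have hyt : y ∉ t := fun h => by
    have := hts h
    simp at this
  set τ : V → Fin 2 := fun z => if z ∈ t then 0 else 1 with hτ
  have hτx : τ x = 1 := by simp only [hτ]; rw [if_neg hxt]
  have hτy : τ y = 1 := by simp only [hτ]; rw [if_neg hyt]
  have hcount : particleCount τ = t.card := by
    unfold particleCount
    congr 1
    ext z
    simp only [Finset.mem_filter, Finset.mem_univ, true_and, hτ]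
    by_cases hz : z ∈ t <;> simp [hz]
  have hsec : particleCount (Function.update τ x 0) = N := by
    rw [particleCount_update τ x hτx, hcount, ht]
    omega
  exact pairMass_pos_of_mem (jastrowSectorAmp w N) x y τ ⟨hτx, hτy⟩ (jastrowSectorAmp_pos w N hZ _ hsec)

/-- **★′ (hypothesis-clean ★, PROVED):** along any sector sequence with `1 ≤ N_L ≤ L² − 1`,
`R8ᶜ ⇒ n₀/|Λ| ≥ (N_L/L²)(1 − N_L/L²)·e^{−C/2}` for the canonical Jastrow–sheet state, `C` independent of `L`.
(theory seat Sketch9 Part K) [folklore] -/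
theorem condensateDensity_sheetSector_ge_of_entropyBoundC' (β c : ℝ) (Nseq : ℕ → ℕ)
    (h : JelliumSheetEntropyBoundC β c Nseq) :
    ∃ C : ℝ, ∀ L : ℕ, ∀ [NeZero L], 1 ≤ Nseq L → Nseq L + 1 ≤ L ^ 2 →
      ((Nseq L : ℝ) / (L : ℝ) ^ 2) * (1 - (Nseq L : ℝ) / (L : ℝ) ^ 2) * Real.exp (-C / 2)
        ≤ condensateDensity (jastrowSectorAmp (sheetKernel L β c) (Nseq L)) := by
  obtain ⟨C, hC⟩ := condensateDensity_sheetSector_ge_of_entropyBoundC β c Nseq h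
  refine ⟨C, fun L _ h1 h2 => ?_⟩
  have hcardN : Fintype.card (TorusSite 2 L) = L ^ 2 := by rw [Fintype.card_fun, ZMod.card, Fintype.card_fin]
  refine hC L ?_ ?_
  · exact jastrowSectorWeight_pos_of_le _ _ (by rw [hcardN]; omega)
  · intro x y hxy
    exact pairMass_jastrowSectorAmp_pos _ _ h1 (by rw [hcardN]; exact h2) x y hxy

/-- **★′ from R8bᶜ (PROVED).** (theory seat Sketch9 Part K `condensate_floor_of_sheetDefectScreeningC'`) [folklore] -/
theorem condensateDensity_sheetSector_ge_of_defectC' (β c : ℝ) (Nseq : ℕ → ℕ)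
    (h : SheetDefectScreeningC β c Nseq) :
    ∃ C : ℝ, ∀ L : ℕ, ∀ [NeZero L], 1 ≤ Nseq L → Nseq L + 1 ≤ L ^ 2 →
      ((Nseq L : ℝ) / (L : ℝ) ^ 2) * (1 - (Nseq L : ℝ) / (L : ℝ) ^ 2) * Real.exp (-C / 2)
        ≤ condensateDensity (jastrowSectorAmp (sheetKernel L β c) (Nseq L)) :=
  condensateDensity_sheetSector_ge_of_entropyBoundC' β c Nseq (jelliumSheetEntropyBoundC_of_defect β c Nseq h)

/-! ### Independence of the diagonal value `c` -/

omit [Fintype V] [DecidableEq V] in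
/-- `n_u² = n_u`. [folklore] -/
theorem occ_mul_self (σ : V → Fin 2) (u : V) : occ σ u * occ σ u = occ σ u := by
  unfold occ; split_ifs <;> simp

omit [DecidableEq V] in
/-- `Σ_u n_u(σ) = N(σ)`. [folklore] -/
theorem sum_occ_eq_particleCount (σ : V → Fin 2) : ∑ u, occ σ u = (particleCount σ : ℝ) := by
  unfold occ particleCount
  rw [Finset.sum_boole]

/-- Shifting the diagonal of the pair kernel by `c` adds `c·N(σ)` to the Jastrow log-weight.
(theory seat Sketch9 Part L) [folklore] -/
theorem jastrowLogWeight_add_diag (w : V → V → ℝ) (c : ℝ) (σ : V → Fin 2) :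
    jastrowLogWeight (fun u v => w u v + if u = v then c else 0) σ
      = jastrowLogWeight w σ + c * particleCount σ := by
  unfold jastrowLogWeight spectatorField
  rw [← sum_occ_eq_particleCount, Finset.mul_sum, ← Finset.sum_add_distrib]
  refine Finset.sum_congr rfl fun u _ => ?_
  have hsplit : ∑ z, occ σ z * (w z u + if z = u then c else 0)
      = ∑ z, occ σ z * w z u + ∑ z, (if z = u then occ σ z * c else 0) := by
    rw [← Finset.sum_add_distrib]
    refine Finset.sum_congr rfl fun z _ => ?_
    split_ifs <;> ring
  rw [hsplit, Finset.sum_ite_eq' Finset.univ u, if_pos (Finset.mem_univ u), mul_add]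
  have := occ_mul_self σ u
  calc occ σ u * ∑ z, occ σ z * w z u + occ σ u * (occ σ u * c)
      = occ σ u * ∑ z, occ σ z * w z u + (occ σ u * occ σ u) * c := by ring
    _ = occ σ u * ∑ z, occ σ z * w z u + c * occ σ u := by rw [this]; ring

/-- The sheet kernel with diagonal `c` is the one with diagonal `0` plus `c·[u = v]`. (theory seat Sketch9 Part L) [folklore] -/
theorem sheetKernel_eq_add_diag (L : ℕ) [NeZero L] (β c : ℝ) :
    sheetKernel L β c = fun u v => sheetKernel L β 0 u v + if u = v then c else 0 := by
  funext u v
  unfold sheetKernel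
  by_cases h : u = v
  · rw [if_pos h, if_pos h, if_pos h]; ring
  · rw [if_neg h, if_neg h, if_neg h]; ring

/-- `ψ_{β,c}(σ) = e^{−cN(σ)/4} ψ_{β,0}(σ)`. (theory seat Sketch9 Part L `sheetSectorAmp_diag`) [folklore] -/
theorem jastrowAmp_sheet_diag (L : ℕ) [NeZero L] (β c : ℝ) (σ : TorusSite 2 L → Fin 2) :
    jastrowAmp (sheetKernel L β c) σ
      = Real.exp (-(c * particleCount σ) / 4) * jastrowAmp (sheetKernel L β 0) σ := by
  unfold jastrowAmp
  rw [sheetKernel_eq_add_diag L β c, jastrowLogWeight_add_diag, ← Real.exp_add]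
  congr 1; ring

/-- `Z_N(β,c) = e^{−cN/2} Z_N(β,0)`. [folklore] -/
theorem jastrowSectorWeight_sheet_diag (L : ℕ) [NeZero L] (β c : ℝ) (N : ℕ) :
    jastrowSectorWeight (sheetKernel L β c) N
      = Real.exp (-(c * N) / 4) ^ 2 * jastrowSectorWeight (sheetKernel L β 0) N := by
  unfold jastrowSectorWeight
  rw [Finset.mul_sum]
  refine Finset.sum_congr rfl fun σ _ => ?_
  split_ifs with h
  · rw [jastrowAmp_sheet_diag, h]; ring
  · ring

/-- **c-independence of the canonical state (PROVED):** the normalised `N`-particle Jastrow–sheet amplitude does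
not depend on the diagonal value `c` (the factor `e^{−cN/4}` is absorbed by `1/√Z_N`).
(theory seat Sketch9 Part L, memo ROTOR-THEORY-9 §135(j)(0a)) [folklore] -/
theorem jastrowSectorAmp_sheet_indep (L : ℕ) [NeZero L] (β c : ℝ) (N : ℕ) :
    jastrowSectorAmp (sheetKernel L β c) N = jastrowSectorAmp (sheetKernel L β 0) N := by
  funext σ
  unfold jastrowSectorAmp
  split_ifs with h
  · rw [jastrowAmp_sheet_diag, h, jastrowSectorWeight_sheet_diag, Real.sqrt_mul (sq_nonneg _),
      Real.sqrt_sq (Real.exp_pos _).le, mul_div_mul_left _ _ (Real.exp_pos _).ne']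
  · rfl

/-- R8bᶜ does not depend on `c`. (theory seat Sketch9 Part L `sheetDefectScreeningC_indep`) [folklore] -/
theorem sheetDefectScreeningC_indep (β c : ℝ) (Nseq : ℕ → ℕ) :
    SheetDefectScreeningC β c Nseq ↔ SheetDefectScreeningC β 0 Nseq := by
  unfold SheetDefectScreeningC
  constructor
  · rintro ⟨C, ε, hε, h⟩
    refine ⟨C, ε, hε, fun L _ x y hxy => ?_⟩
    rw [← jastrowSectorAmp_sheet_indep L β c]
    exact h L x y hxy
  · rintro ⟨C, ε, hε, h⟩
    refine ⟨C, ε, hε, fun L _ x y hxy => ?_⟩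
    rw [jastrowSectorAmp_sheet_indep L β c]
    exact h L x y hxy

/-- R8ᶜ does not depend on `c`. (theory seat Sketch9 Part L `jelliumSheetEntropyBoundC_indep`) [folklore] -/
theorem jelliumSheetEntropyBoundC_indep (β c : ℝ) (Nseq : ℕ → ℕ) :
    JelliumSheetEntropyBoundC β c Nseq ↔ JelliumSheetEntropyBoundC β 0 Nseq := by
  unfold JelliumSheetEntropyBoundC
  constructor
  · rintro ⟨C, h⟩
    refine ⟨C, fun L _ x y hxy => ?_⟩
    rw [← jastrowSectorAmp_sheet_indep L β c]
    exact h L x y hxy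
  · rintro ⟨C, h⟩
    refine ⟨C, fun L _ x y hxy => ?_⟩
    rw [jastrowSectorAmp_sheet_indep L β c]
    exact h L x y hxy

end SheetSector

end Summit.HubbardSuperconductivity.HubbardSuperconductivity.Theorems.AnisotropyChord.InsertionEntropy
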